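import Literature.Computability.Complexity.GateEliminationCase822K
import Literature.Computability.Complexity.GateEliminationCase82Conf

/-!
# Gate elimination: Case 8.2.2 of Li–Yang's proof of Theorem 4.1 (with Cases 8.2.5.x)

Li–Yang, ECCC TR21-023, §4.1, Case 8.2.2 (p. 31): "Assume that `Q` is a `2⁺`-gate. Let `x_j ∈ I`
be a protected variable and `x_k` be its couple. We try to substitute `x_k ← d` and normalize the
circuit. After Case 6, exactly one gate (the descendant of `x_k`) is eliminated and
`Δμ = 1 + α_I + α_Q`. (8.2.2.1) … We substitute appropriate constant to `Q` via
xor-reconstruction such that `G` is trivialized, further degenerating `A`, `B` and `C` … the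
net potential increment is bounded by `2`, which gives `Δμ ≥ 4 - 2α_φ + α_I` for this
substitution. Then the two substitutions, in average, produce
`Δμ ≥ (5 - 2α_φ + 2α_I + α_Q)/2 ≥ δ`. (8.2.2.2) If `Q` is fed by `x_k` … we can apply the
argument in the previous case with `Q` replaced by `Q′`", together with the deferred
configurations of Case 8.2.5 (pp. 35–40).

`ProtSubstSit.case8_2_2` PROVES this case from the hypothesis `Case82Hyp` of the dispatcher
(`GateEliminationCase8Dispatch.lean`) when `fanout(Q) ≥ 2`. The xor-reconstruction step inside
the circuit `K` after `x_k := d` is `case8_2_2_K` (`GateEliminationCase822K.lean`); its three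
special outcomes are mapped back to `C` here:

* Case 8.2.5.1 (`stepGoal_of_conf8251`): the other wire of `G` is a `3`-variable `x_m` of `K`;
  in `C` this is Case 3 (excluded), or `P_k = x_k ⊕ x_m` with `x_m` a `1`-variable
  (Cases 6.2.2.1–6.2.2.3) or a `2`-variable (Case 8.1 at an ∧-type reader of `P_k`, which
  depends on the unprotected `x_m`; `P_k` is absorbed into the xor-part).
* Case 8.2.5.2 on a one-gate path (`stepGoal_of_conf8252a`): `I = x_j ⊕ x_ℓ ⊕ c` with `x_ℓ`
  protected and read three times in `K`: Case 1 inside `K` (`stepGoal_of_protected_fanout_three`,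
  `Δμ ≥ (1 + α_I + α_Q) + (3 - 3α_φ + α_I + α_Q) ≥ 2δ`).
* Case 8.2.5.2 on a longer path: an ∧-type gate `T` reads the path gate `B` preceding `I`; if
  `B` depends on an unprotected variable, Case 8.1 applies to `T` in `C` (the printed
  Cases 8.2.5.2.1.2–8.2.5.2.1.5); otherwise `T`, `B` and the shorter path satisfy the hypotheses
  again, and `case8_2_2_induct` recurses on the length of the path (this replaces the third
  substitution of the printed Case 8.2.5.2.2 and the remarks 8.2.5.3–8.2.5.4).

No statement of the chain is changed; `LiYang2022_cases6to8` still needs Cases 8.2.3–8.2.4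
(`fanout(Q) = 1`).

## References

* J. Li, T. Yang, *3.1n − o(n) circuit lower bounds for explicit functions*, STOC 2022
  [LiYang2022]; full version ECCC TR21-023, §4.1 (Cases 8.1, 8.2.1, 8.2.2, 8.2.5), §2.6, §3.3.
-/

namespace Literature.Computability.Complexity

open Finset

namespace Semicircuit

variable {n : ℕ} {C : Semicircuit n} {f : (Fin n → ZMod 2) → Bool} {R : RdqSource n} {d : ℕ} {αφ αI αQ : ℝ}

/-! ### Dependence through a ⊕-type gate, converse direction -/

/-- **Dependence passes from the gate wire of a ⊕-type gate to the gate**: if `Q = x_k ⊕ Q'' ⊕ c`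
and `Q''` depends on `x_j ≠ x_k`, so does `Q`. [cite: LiYang2022, §4.1 (Case 8.2.2.2)] -/
theorem dependsOn_of_reads_gate (hF : C.Fair) {Q Q'' : Fin C.m} (hQK : Q ∈ C.xorPart) {a : Fin 2} {xk xj : Fin n}
    (hQk : C.arg Q a = .var xk) (hQQ : C.arg Q a.rev = .gate Q'') (hjk : xj ≠ xk) (hdep : C.DependsOn hF Q'' xj) :
    C.DependsOn hF Q xj := by
  by_contra hnot
  have hall : ∀ y : Fin n → Bool, C.sol hF (Function.update y xj (!y xj)) Q = C.sol hF y Q := by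
    intro y
    by_contra hne
    exact hnot (C.dependsOn_of_exists hF hQK ⟨y, hne⟩)
  obtain ⟨c, hc⟩ := C.sol_eq_xor_of_isXorOp hF (C.isXorOp_of_mem Q hQK)
  have h := hall (fun _ => false)
  rw [hc, hc] at h
  have key : ∀ y : Fin n → Bool,
      C.nodeVal (Function.update y xj (!y xj)) (C.sol hF (Function.update y xj (!y xj))) (C.arg Q a) =
        C.nodeVal y (C.sol hF y) (C.arg Q a) := by
    intro y
    rw [hQk]
    show Function.update y xj (!y xj) xk = y xk
    rw [Function.update_of_ne hjk.symm]
  have key' : ∀ y : Fin n → Bool, C.nodeVal y (C.sol hF y) (C.arg Q a.rev) = C.sol hF y Q'' := by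
    intro y; rw [hQQ]; rfl
  apply hdep (fun _ => false)
  rcases fin2_eq_or_eq_rev 0 a with rfl | h1
  · have h0 : C.arg Q 0 = .var xk := hQk
    have h1 : C.arg Q 1 = .gate Q'' := hQQ
    rw [h0, h1] at h
    change ((Function.update (fun _ : Fin n => false) xj (!false) xk ^^
        C.sol hF (Function.update (fun _ : Fin n => false) xj (!false)) Q'') ^^ c) =
      ((false ^^ C.sol hF (fun _ : Fin n => false) Q'') ^^ c) at h
    rw [Function.update_of_ne hjk.symm] at h
    revert h
    generalize C.sol hF (Function.update (fun _ : Fin n => false) xj (!false)) Q'' = β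
    generalize C.sol hF (fun _ : Fin n => false) Q'' = γ
    cases β <;> cases γ <;> cases c <;> decide
  · have ha : a = 1 := h1
    subst ha
    have h0 : C.arg Q 0 = .gate Q'' := hQQ
    rw [h0, hQk] at h
    change ((C.sol hF (Function.update (fun _ : Fin n => false) xj (!false)) Q'' ^^
        Function.update (fun _ : Fin n => false) xj (!false) xk) ^^ c) =
      ((C.sol hF (fun _ : Fin n => false) Q'' ^^ false) ^^ c) at h
    rw [Function.update_of_ne hjk.symm] at h
    revert h
    generalize C.sol hF (Function.update (fun _ : Fin n => false) xj (!false)) Q'' = β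
    generalize C.sol hF (fun _ : Fin n => false) Q'' = γ
    cases β <;> cases γ <;> cases c <;> decide

/-! ### Case 8.1 at a ⊕-type gate reading two variables, absorbed into the xor-part -/

/-- **Case 8.1 for an ∧-type gate reading a ⊕-type gate `P = y ⊕ u ⊕ c` fed by two variables**,
`u` unprotected: `P` (whose inputs are variables) is absorbed into the xor-part, where it depends
on `u`, and `case8_1` applies. [cite: LiYang2022, §4.1 (Case 8.1, Cases 8.2.5.1.3.1–2)] -/
theorem stepGoal_case8_1_varXor (hf : IsAffineDisperser f d) (hd : 2 * d + 2 < R.dim) (hF : C.Fair)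
    (hC : C.ComputesRestr f R) (hS : C.Standing R) (hφ : 0 ≤ αφ) (hφ1 : αφ ≤ 1) (hI : 0 ≤ αI) (αQ : ℝ)
    {P G₀ : Fin C.m} {aP a₀ : Fin 2} {y u : Fin n}
    (hPy : C.arg P aP = .var y) (hPu : C.arg P aP.rev = .var u) (hyu : y ≠ u) (hPxor : IsXorOp (C.op P))
    (hand : IsAndOp (C.op G₀)) (hG₀P : C.arg G₀ a₀ = .gate P) (hup : ¬ R.Protected u)
    (hshape : 2 ≤ C.fanout (.gate P) ∨ (∃ t, C.arg G₀ a₀.rev = .var t) ∨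
      ∃ Pg, C.arg G₀ a₀.rev = .gate Pg ∧ Pg ∈ C.xorPart ∧ C.fanout (.gate Pg) = 1) :
    C.StepGoal f R αφ αI αQ := by
  have hxor : ∀ k ∈ ({P} : Finset (Fin C.m)), IsXorOp (C.op k) := by
    intro k hk; rw [mem_singleton] at hk; subst hk; exact hPxor
  have hclosed : ∀ k ∈ ({P} : Finset (Fin C.m)), ∀ (a : Fin 2) (k' : Fin C.m), C.arg k a = .gate k' →
      k' ∈ C.xorPart ∨ k' ∈ ({P} : Finset (Fin C.m)) := by
    intro k hk a k' h
    rw [mem_singleton] at hk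
    subst hk
    exfalso
    rcases fin2_eq_or_eq_rev aP a with rfl | rfl
    · rw [hPy] at h; cases h
    · rw [hPu] at h; cases h
  let C₁ := C.absorb {P} hxor hclosed
  have hF₁ : C₁.Fair := (C.fair_absorb_iff _ _ _).mpr hF
  have hC₁ : C₁.ComputesRestr f R := (C.computesRestr_absorb_iff _ _ _ f R).mpr hC
  have hS₁ : C₁.Standing R := C.standing_absorb _ _ _ hS
  have hPK₁ : P ∈ C₁.xorPart := mem_union_right _ (mem_singleton_self P)
  have hdep : C₁.DependsOn hF₁ P u := dependsOn_var_of_reads_vars hF₁ hPK₁ hPy hPu hyu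
  have hshape₁ : 2 ≤ C₁.fanout (.gate P) ∨ (∃ t, C₁.arg G₀ a₀.rev = .var t) ∨
      ∃ Pg, C₁.arg G₀ a₀.rev = .gate Pg ∧ Pg ∈ C₁.xorPart ∧ C₁.fanout (.gate Pg) = 1 := by
    rcases hshape with h | h | ⟨Pg, h1, h2, h3⟩
    · exact Or.inl h
    · exact Or.inr (Or.inl h)
    · exact Or.inr (Or.inr ⟨Pg, h1, mem_union_left _ h2, h3⟩)
  have h := case8_1 (C := C₁) hf hd hF₁ hC₁ C₁.isPacking_empty hφ hφ1 hI αQ hS₁ hand hG₀P hPK₁ hdep hup hshape₁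
  exact (C.stepGoal_absorb_iff {P} hxor hclosed αφ αI αQ).mp (stepGoal_of_stepBranch2 h)

/-- Solutions are unchanged by absorption. [folklore] -/
theorem sol_absorb (S : Finset (Fin C.m)) (hxor : ∀ k ∈ S, IsXorOp (C.op k))
    (hclosed : ∀ k ∈ S, ∀ (a : Fin 2) (k' : Fin C.m), C.arg k a = .gate k' → k' ∈ C.xorPart ∨ k' ∈ S)
    (hF : C.Fair) (hF₁ : (C.absorb S hxor hclosed).Fair) (x : Fin n → Bool) :
    (C.absorb S hxor hclosed).sol hF₁ x = C.sol hF x := by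
  have h := (C.absorb S hxor hclosed).consistent_sol hF₁ x
  rw [consistent_absorb_iff] at h
  exact h.eq_sol hF

/-- Dependence is unchanged by absorption. [folklore] -/
theorem dependsOn_absorb (S : Finset (Fin C.m)) (hxor : ∀ k ∈ S, IsXorOp (C.op k))
    (hclosed : ∀ k ∈ S, ∀ (a : Fin 2) (k' : Fin C.m), C.arg k a = .gate k' → k' ∈ C.xorPart ∨ k' ∈ S)
    (hF : C.Fair) (hF₁ : (C.absorb S hxor hclosed).Fair) {I : Fin C.m} {s : Fin n} (h : C.DependsOn hF I s) :
    (C.absorb S hxor hclosed).DependsOn hF₁ I s := by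
  intro x
  rw [sol_absorb S hxor hclosed hF hF₁, sol_absorb S hxor hclosed hF hF₁]
  exact h x

/-- **Case 8.1 for an ∧-type gate reading a ⊕-type gate `P = y ⊕ B ⊕ c`** (`y` a variable, `B` a
gate of the xor-part depending on the unprotected `s ≠ y`): `P` is absorbed into the xor-part,
where it depends on `s`, and `case8_1` applies. [cite: LiYang2022, §4.1 (Case 8.1, Case 8.2.5.2.1.3)] -/
theorem stepGoal_case8_1_varGate (hf : IsAffineDisperser f d) (hd : 2 * d + 2 < R.dim) (hF : C.Fair)
    (hC : C.ComputesRestr f R) (hS : C.Standing R) (hφ : 0 ≤ αφ) (hφ1 : αφ ≤ 1) (hI : 0 ≤ αI) (αQ : ℝ)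
    {P G₀ Bg : Fin C.m} {aP a₀ : Fin 2} {y s : Fin n}
    (hPy : C.arg P aP = .var y) (hPB : C.arg P aP.rev = .gate Bg) (hBg : Bg ∈ C.xorPart) (hPxor : IsXorOp (C.op P))
    (hdeps : C.DependsOn hF Bg s) (hsy : s ≠ y) (hsp : ¬ R.Protected s)
    (hand : IsAndOp (C.op G₀)) (hG₀P : C.arg G₀ a₀ = .gate P)
    (hshape : 2 ≤ C.fanout (.gate P) ∨ (∃ t, C.arg G₀ a₀.rev = .var t) ∨
      ∃ Pg, C.arg G₀ a₀.rev = .gate Pg ∧ Pg ∈ C.xorPart ∧ C.fanout (.gate Pg) = 1) :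
    C.StepGoal f R αφ αI αQ := by
  have hxor : ∀ k ∈ ({P} : Finset (Fin C.m)), IsXorOp (C.op k) := by
    intro k hk; rw [mem_singleton] at hk; subst hk; exact hPxor
  have hclosed : ∀ k ∈ ({P} : Finset (Fin C.m)), ∀ (a : Fin 2) (k' : Fin C.m), C.arg k a = .gate k' →
      k' ∈ C.xorPart ∨ k' ∈ ({P} : Finset (Fin C.m)) := by
    intro k hk a k' h
    rw [mem_singleton] at hk
    subst hk
    rcases fin2_eq_or_eq_rev aP a with rfl | rfl
    · rw [hPy] at h; cases h
    · rw [hPB] at h; cases h; exact Or.inl hBg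
  let C₁ := C.absorb {P} hxor hclosed
  have hF₁ : C₁.Fair := (C.fair_absorb_iff _ _ _).mpr hF
  have hC₁ : C₁.ComputesRestr f R := (C.computesRestr_absorb_iff _ _ _ f R).mpr hC
  have hS₁ : C₁.Standing R := C.standing_absorb _ _ _ hS
  have hPK₁ : P ∈ C₁.xorPart := mem_union_right _ (mem_singleton_self P)
  have hdepB : C₁.DependsOn hF₁ Bg s := C.dependsOn_absorb {P} hxor hclosed hF hF₁ hdeps
  have hdep : C₁.DependsOn hF₁ P s := dependsOn_of_reads_gate hF₁ hPK₁ hPy hPB hsy hdepB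
  have hshape₁ : 2 ≤ C₁.fanout (.gate P) ∨ (∃ t, C₁.arg G₀ a₀.rev = .var t) ∨
      ∃ Pg, C₁.arg G₀ a₀.rev = .gate Pg ∧ Pg ∈ C₁.xorPart ∧ C₁.fanout (.gate Pg) = 1 := by
    rcases hshape with h | h | ⟨Pg, h1, h2, h3⟩
    · exact Or.inl h
    · exact Or.inr (Or.inl h)
    · exact Or.inr (Or.inr ⟨Pg, h1, mem_union_left _ h2, h3⟩)
  have h := case8_1 (C := C₁) hf hd hF₁ hC₁ C₁.isPacking_empty hφ hφ1 hI αQ hS₁ hand hG₀P hPK₁ hdep hsp hshape₁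
  exact (C.stepGoal_absorb_iff {P} hxor hclosed αφ αI αQ).mp (stepGoal_of_stepBranch2 h)

namespace ProtSubstSit

variable (S : C.ProtSubstSit f R αφ αI αQ)

/-- **Dependencies of `K` come from `C`**: a gate of the xor-part of `K` depending on `x_s`
corresponds to a gate of `C` depending on `x_s`. [cite: LiYang2022, §4.1 (Case 8.2.5.2.1)] -/
theorem dependsOn_C (hF : C.Fair) {k' : Fin S.K.m} (hk' : k' ∈ S.K.xorPart) {s : Fin n}
    (h : S.K.DependsOn S.fair k' s) : C.DependsOn hF (S.E.ι k') s := by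
  have hkC : S.E.ι k' ∈ C.xorPart := (S.mem_xorPart_iff k').mp hk'
  by_cases hs : s = S.xk
  · subst hs
    exfalso
    have h1 := h (fun _ => false)
    rw [S.sol_eq hF, S.sol_eq hF] at h1
    apply h1
    rw [Function.update_idem]
  · refine C.dependsOn_of_exists hF hkC ⟨Function.update (fun _ => false) S.xk (finTwoEquiv S.dd), ?_⟩
    have h1 := h (fun _ => false)
    rw [S.sol_eq hF, S.sol_eq hF] at h1
    have hY : Function.update (Function.update (fun _ : Fin n => false) S.xk (finTwoEquiv S.dd)) s
        (!Function.update (fun _ : Fin n => false) S.xk (finTwoEquiv S.dd) s) =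
        Function.update (Function.update (fun _ : Fin n => false) s (!(fun _ : Fin n => false) s)) S.xk
          (finTwoEquiv S.dd) := by
      rw [Function.update_of_ne hs, Function.update_comm (Ne.symm hs)]
    rw [hY]
    intro h2
    exact h1 (by rw [h2])

section Standing

variable (hS : C.Standing R)
include hS

/-- No wire of `K` reads `x_k`. [folklore] -/
theorem arg_ne_var_xk (k' : Fin S.K.m) (a : Fin 2) : S.K.arg k' a ≠ .var S.xk := by
  intro h
  rcases (S.E.arg_eq_var_iff k' a S.xk).mp h with h' | ⟨-, h'⟩
  · exact (Node.substConst_eq_var_iff.mp h').2 rfl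
  · rw [S.hrepl] at h'
    exact PreNormalized.arg_ne_arg_rev hS.normalized.1 S.Pk S.ak (S.hPk.trans h'.symm)

/-- **A variable wire of `K`** is that wire of `C`, or a wire into `P_k` whose other input is
that variable. [cite: LiYang2022, §3.3 (Rule 3)] -/
theorem arg_var_cases {k' : Fin S.K.m} {a : Fin 2} {i : Fin n} (h : S.K.arg k' a = .var i) :
    C.arg (S.E.ι k') a = .var i ∨ (C.arg (S.E.ι k') a = .gate S.Pk ∧ C.arg S.Pk S.ak.rev = .var i) := by
  rcases (S.E.arg_eq_var_iff k' a i).mp h with h' | ⟨h', hr⟩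
  · rw [S.arg_C₀_of_ne hS (S.E.ι_ne k')] at h'
    exact Or.inl h'
  · rw [S.arg_C₀_of_ne hS (S.E.ι_ne k')] at h'
    rw [S.hrepl] at hr
    exact Or.inr ⟨h', hr⟩

/-- **A gate wire of `K`** is that wire of `C`, or a wire into `P_k` whose other input is that
gate. [cite: LiYang2022, §3.3 (Rule 3)] -/
theorem arg_gate_cases {k' k'' : Fin S.K.m} {a : Fin 2} (h : S.K.arg k' a = .gate k'') :
    C.arg (S.E.ι k') a = .gate (S.E.ι k'') ∨
      (C.arg (S.E.ι k') a = .gate S.Pk ∧ C.arg S.Pk S.ak.rev = .gate (S.E.ι k'')) := by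
  rcases (S.E.arg_eq_gate_iff k' a k'').mp h with h' | ⟨h', hr⟩
  · rw [S.arg_C₀_of_ne hS (S.E.ι_ne k')] at h'
    exact Or.inl h'
  · rw [S.arg_C₀_of_ne hS (S.E.ι_ne k')] at h'
    rw [S.hrepl] at hr
    exact Or.inr ⟨h', hr⟩

end Standing

/-- **Out-degree of the other wire of `P_k` when it is a variable**:
`fanout_K + 1 = fanout + fanout(P_k)`. [cite: LiYang2022, §3.3 (Rule 3)] -/
theorem fanout_repl_var {u : Fin n} (hr : C.arg S.Pk S.ak.rev = .var u) (hu : u ≠ S.xk) :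
    S.K.fanout (.var u) + 1 = C.fanout (.var u) + C.fanout (.gate S.Pk) := by
  classical
  have h := S.E.fanout_repl_add
  rw [S.hrepl, hr] at h
  have hpull : S.E.pull (.var u) = .var u := rfl
  have hc1 : (univ.filter fun a' : Fin 2 => S.C₀.arg S.Pk a' = .var u).card = 1 := by
    rw [card_eq_one]
    refine ⟨S.ak.rev, ?_⟩
    ext a'
    rw [mem_filter, mem_singleton]
    constructor
    · rintro ⟨-, h'⟩
      have h'' := Node.substConst_eq_var_iff.mp h'
      rcases fin2_eq_or_eq_rev S.ak a' with rfl | rfl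
      · rw [S.hPk] at h''; exact absurd (Node.var.inj h''.1).symm hu
      · rfl
    · rintro rfl
      refine ⟨mem_univ _, ?_⟩
      show (C.arg S.Pk S.ak.rev).substConst S.xk _ = _
      rw [hr, Node.substConst_var_of_ne hu]
  rw [hpull, hc1, C.fanout_substConst_var_of_ne _ _ hu, C.fanout_substConst_gate] at h
  exact h

/-- `K` does not depend on `x_k` (it is the circuit after `x_k := d`). [folklore] -/
theorem not_dependsOn_xk (hF : C.Fair) (k' : Fin S.K.m) : ¬ S.K.DependsOn S.fair k' S.xk := by
  intro h
  have h1 := h (fun _ => false)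
  rw [S.sol_eq hF, S.sol_eq hF] at h1
  apply h1
  rw [Function.update_idem]

/-- Which variables the killed equation reads. [folklore] -/
theorem eq_or_eq_of_reads {i : Fin n} (h : S.e.Reads i) : i = S.xj ∨ i = S.xk := by
  have hne := S.xj_ne_xk
  rcases h with h | h <;> rcases S.hjr with hj | hj <;> rcases S.hkr with hk | hk
  · exact Or.inl (h.symm.trans hj)
  · exact Or.inl (h.symm.trans hj)
  · exact Or.inr (h.symm.trans hk)
  · exact absurd (hj.symm.trans hk) hne
  · exact absurd (hj.symm.trans hk) hne
  · exact Or.inr (h.symm.trans hk)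
  · exact Or.inl (h.symm.trans hj)
  · exact Or.inr (h.symm.trans hk)

/-- **Case 1 inside `K`** (a protected variable `x_l ∉ {x_j, x_k}` read by three gates of `K`):
the substitution `x_l := c` kills its quadratic equation and a free variable and is followed by
three eliminations (Rules 2/3); with the first substitution,
`Δμ ≥ (1 + α_I + α_Q) + (3 - 3α_φ + α_I + α_Q) ≥ 2δ`. [cite: LiYang2022, §4.1 (Case 1, Case 8.2.5.2)] -/
theorem stepGoal_of_protected_fanout_three (hf : IsAffineDisperser f d) (hd : 2 * d + 2 < R.dim)
    (hφ : 0 ≤ αφ) (hI : 0 ≤ αI)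
    {xl : Fin n} (hxl : R.Protected xl) (hlj : xl ≠ S.xj) (hlk : xl ≠ S.xk) (h3 : 3 ≤ S.K.fanout (.var xl)) :
    C.StepGoal f R αφ αI αQ := by
  classical
  -- `x_l` is protected in `R₁`: its quadratic equation is not the killed one
  obtain ⟨hfree, l', e', he', hr'⟩ := hxl
  have hl' : l' ≠ S.l := by
    intro hll
    rw [hll, S.he] at he'
    cases he'
    rcases S.eq_or_eq_of_reads hr' with h | h
    · exact hlj h
    · exact hlk h
  have he₁ : S.R₁.quad l' = some e' := by
    rw [RdqSource.assignProtected_quad_of_ne S.he S.hkr S.dd hl']; exact he'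
  have hr₁ : e'.Reads xl := hr'
  -- the substitution `x_l := 0` in `K`
  have hF₁ : (S.K.substConst xl (finTwoEquiv (0 : ZMod 2))).Fair := S.fair.substConst xl _
  have hC₁ : (S.K.substConst xl (finTwoEquiv (0 : ZMod 2))).ComputesRestr f
      (RdqSource.assignProtected he₁ hr₁ 0) := S.computes.substConst_assignProtected he₁ hr₁ 0
  have hP₁ : (S.K.substConst xl (finTwoEquiv (0 : ZMod 2))).IsPacking
      (S.K.substConstPacking xl (finTwoEquiv (0 : ZMod 2)) ∅) := S.K.isPacking_empty.substConst
  have hdim₂ := RdqSource.dim_assignProtected he₁ hr₁ 0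
  have hdim₁ := S.dim_add_one
  have hd₂ : 2 * d + 1 ≤ (RdqSource.assignProtected he₁ hr₁ 0).dim := by omega
  -- three readers of `x_l` are now fed by a constant
  have h3doom : 3 ≤ (S.K.substConst xl (finTwoEquiv (0 : ZMod 2))).doomed.card := by
    refine le_trans ?_ (S.K.substConst xl (finTwoEquiv (0 : ZMod 2))).constFedCount_le_card_doomed
    unfold constFedCount
    rw [S.K.fanout_eq_card_readers S.normalized.1.arg_zero_ne_arg_one] at h3
    refine le_trans h3 (card_le_card fun k hk => ?_)
    obtain ⟨-, a, ha⟩ := mem_filter.mp hk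
    refine mem_filter.mpr ⟨mem_univ _, a, finTwoEquiv 0, ?_⟩
    show (S.K.arg k a).substConst xl (finTwoEquiv 0) = .const (finTwoEquiv 0)
    rw [ha, Node.substConst_var_self]
  obtain ⟨D', P'', hFD, hCD, hPD, -, hμD⟩ :=
    cascade_doomed' hf hd₂ hφ hI αQ 3 (S.K.substConst xl (finTwoEquiv (0 : ZMod 2))) _ hF₁ hC₁ hP₁ h3doom
  -- accounting
  have hsub := measure_substConst_le hφ αI αQ S.K.isPacking_empty S.R₁ (RdqSource.assignProtected he₁ hr₁ 0) xl
    (finTwoEquiv (0 : ZMod 2))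
  have hlinf : xl ∈ S.K.influential S.R₁ := by
    unfold influential
    rw [mem_filter]
    exact ⟨mem_univ _, Or.inr (RdqSource.protected_of_reads he₁ hr₁)⟩
  have hinf : (((S.K.substConst xl (finTwoEquiv (0 : ZMod 2))).influential
      (RdqSource.assignProtected he₁ hr₁ 0)).card : ℝ) + 1 ≤ (S.K.influential S.R₁).card := by
    have h1 := card_le_card (S.K.influential_substConst_assignProtected_subset he₁ hr₁ 0 (finTwoEquiv (0 : ZMod 2)))
    have h2 : (((S.K.influential S.R₁).erase xl).filter fun i => e'.Reads i → 1 ≤ S.K.fanout (.var i)).card ≤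
        ((S.K.influential S.R₁).erase xl).card := card_filter_le _ _
    have h3 := card_erase_of_mem hlinf
    have h4 := card_pos.mpr ⟨xl, hlinf⟩
    have : ((S.K.substConst xl (finTwoEquiv (0 : ZMod 2))).influential
        (RdqSource.assignProtected he₁ hr₁ 0)).card + 1 ≤ (S.K.influential S.R₁).card := by omega
    exact_mod_cast this
  have hq : ((S.R₁.quadCount : ℝ)) - (RdqSource.assignProtected he₁ hr₁ 0).quadCount = 1 := by
    have := RdqSource.quadCount_assignProtected he₁ hr₁ 0
    have h : ((RdqSource.assignProtected he₁ hr₁ 0).quadCount : ℝ) + 1 = S.R₁.quadCount := by exact_mod_cast this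
    linarith
  rw [hq, mul_one] at hsub
  have h1 : αI ≤ αI * (((S.K.influential S.R₁).card : ℝ) -
      ((S.K.substConst xl (finTwoEquiv (0 : ZMod 2))).influential (RdqSource.assignProtected he₁ hr₁ 0)).card) := by
    have h2 : (1 : ℝ) ≤ ((S.K.influential S.R₁).card : ℝ) -
        ((S.K.substConst xl (finTwoEquiv (0 : ZMod 2))).influential (RdqSource.assignProtected he₁ hr₁ 0)).card := by
      linarith
    have := mul_le_mul_of_nonneg_left h2 hI
    rwa [mul_one] at this
  have hμS := S.measure_le
  have hδ := liYangDelta_le_case1 αφ αI αQ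
  have hdim' : (RdqSource.assignProtected he₁ hr₁ 0).dim + 2 = R.dim := by omega
  refine Or.inr ⟨2, by norm_num, by norm_num, D', RdqSource.assignProtected he₁ hr₁ 0, P'', hFD, hCD, hPD, hdim', ?_⟩
  push_cast at hμD ⊢
  nlinarith

section Standing

variable (hS : C.Standing R)
include hS

/-- **Case 8.2.5.1, mapped back to `C`**: in `K`, the ∧-type gate `G` reads a `3`-variable `x_m`
read by another ∧-type gate `T`. In `C`: if `x_m` is not the other wire of `P_k`, `G` reads the
`3`-variable `x_m` directly — Case 3 (an ∧-type output reads no variable); otherwise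
`P_k = x_k ⊕ x_m` and `fanout(x_m) + fanout(P_k) = 4`: `x_m` a `1`-variable is Case 8.2.5.1.2
(Cases 6.2.2.1–6.2.2.3, `case6_2_2_oneVar`); a `3`-variable is Case 8.2.5.1.1 (Case 3 again, at
`G` or `T`); a `2`-variable with `P_k` a `2`-gate is Case 8.2.5.1.3: Case 8.1 at the ∧-type gate
(`G` or `T`) reading `P_k`, which depends on the unprotected `x_m` (`case8_1`, `P_k` absorbed into
the xor-part). [cite: LiYang2022, §4.1 (Cases 8.2.5.1, 8.2.5.1.1–8.2.5.1.3)] -/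
theorem stepGoal_of_conf8251 (hf : IsAffineDisperser f d) (hd : 2 * d + 2 < R.dim) (hF : C.Fair)
    (hC : C.ComputesRestr f R) (hφ : 0 ≤ αφ) (hφ2 : αφ ≤ 1 / 2) (hI : 0 ≤ αI) (hQ : 0 ≤ αQ)
    {kG T : Fin S.K.m} {aG aT : Fin 2} {xm : Fin n}
    (hand : IsAndOp (S.K.op kG)) (hGm : S.K.arg kG aG = .var xm) (hfm : S.K.fanout (.var xm) = 3)
    (hTG : T ≠ kG) (hTand : IsAndOp (S.K.op T)) (hTm : S.K.arg T aT = .var xm) :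
    C.StepGoal f R αφ αI αQ := by
  classical
  have hPN := hS.normalized.1
  have handC : IsAndOp (C.op (S.E.ι kG)) := (S.E.isAndOp_iff kG).mp hand
  have hTandC : IsAndOp (C.op (S.E.ι T)) := (S.E.isAndOp_iff T).mp hTand
  have hmk : xm ≠ S.xk := fun e => S.arg_ne_var_xk hS kG aG (e ▸ hGm)
  -- an ∧-type gate of `C` reading a `3`-variable: Case 3 makes it a `0`-gate, the output — impossible
  have hno3 : ∀ {G' : Fin C.m} {a : Fin 2}, IsAndOp (C.op G') → C.arg G' a = .var xm →
      C.fanout (.var xm) = 3 → False := by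
    intro G' a hand' hG'm h3
    have hle := hS.and_fanout_le xm G' a hG'm hand'
    have h0 : C.fanout (.gate G') = 0 := by omega
    exact false_of_and_out_reads_var hf (by omega) hF hC (hPN.out_of_fanout_eq_zero G' h0) hand' hG'm
  by_cases hr : C.arg S.Pk S.ak.rev = .var xm
  · -- `P_k = x_k ⊕ x_m`
    have hsum : C.fanout (.var xm) + C.fanout (.gate S.Pk) = 4 := by
      have := S.fanout_repl_var hr hmk; omega
    have hPxor : IsXorOp (C.op S.Pk) := hS.isXorOp_of_protected S.protected_xk S.hPk
    by_cases h1 : C.fanout (.var xm) = 1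
    · exact case6_2_2_oneVar hf hd hF hC hS hφ hφ2 hI hQ S.hPk hr S.protected_xk h1
    have hxmp : ¬ R.Protected xm := fun h => h1 (hS.fanout_eq_one_of_protected h hr)
    rcases S.arg_var_cases hS hGm with hGmC | ⟨hGP, -⟩
    · -- `G` reads `x_m` directly in `C`
      by_cases h3 : C.fanout (.var xm) = 3
      · exact (hno3 handC hGmC h3).elim
      have hm1 : 1 ≤ C.fanout (.var xm) := fanout_pos_of_arg_eq hr
      have hP1 : 0 < C.fanout (.gate S.Pk) :=
        fanout_pos_of_protected_reader hf (by omega) hF hC hS S.hPk S.protected_xk (fun k hk => by rw [hr] at hk; cases hk)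
      have h2 : C.fanout (.var xm) = 2 := by omega
      rcases S.arg_var_cases hS hTm with hTmC | ⟨hTP, -⟩
      · -- three readers of the `2`-variable `x_m`
        exfalso
        have hcard : ({S.E.ι kG, S.E.ι T, S.Pk} : Finset (Fin C.m)).card ≤ C.fanout (.var xm) := by
          refine le_trans (card_le_card ?_) (C.card_readers_le_fanout (.var xm))
          intro k hk
          simp only [mem_insert, mem_singleton] at hk
          rcases hk with rfl | rfl | rfl
          · exact mem_filter.mpr ⟨mem_univ _, aG, hGmC⟩
          · exact mem_filter.mpr ⟨mem_univ _, aT, hTmC⟩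
          · exact mem_filter.mpr ⟨mem_univ _, S.ak.rev, hr⟩
        have h3le : 3 ≤ ({S.E.ι kG, S.E.ι T, S.Pk} : Finset (Fin C.m)).card := by
          rw [card_insert_of_notMem, card_pair (S.E.ι_ne T)]
          simp only [mem_insert, mem_singleton, not_or]
          exact ⟨fun e => hTG (S.E.ι_injective e).symm, S.E.ι_ne kG⟩
        omega
      · -- `T` reads `P_k`, a `2`-gate depending on the unprotected `x_m`: Case 8.1
        exact stepGoal_case8_1_varXor hf hd hF hC hS hφ (by linarith) hI αQ S.hPk hr hmk.symm hPxor
          hTandC hTP hxmp (Or.inl (by omega))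
    · -- `G` reads `P_k` in `C`
      by_cases h3 : C.fanout (.var xm) = 3
      · exfalso
        rcases S.arg_var_cases hS hTm with hTmC | ⟨hTP, -⟩
        · exact hno3 hTandC hTmC h3
        · have := two_le_fanout_of_ne (D := C) (fun e => hTG (S.E.ι_injective e)) hTP hGP
          omega
      have hm1 : 1 ≤ C.fanout (.var xm) := fanout_pos_of_arg_eq hr
      have hP1 : 1 ≤ C.fanout (.gate S.Pk) := fanout_pos_of_arg_eq hGP
      exact stepGoal_case8_1_varXor hf hd hF hC hS hφ (by linarith) hI αQ S.hPk hr hmk.symm hPxor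
        handC hGP hxmp (Or.inl (by omega))
  · -- `G` reads `x_m` directly in `C`, a `3`-variable there too
    exfalso
    rcases S.arg_var_cases hS hGm with hGmC | ⟨-, hr'⟩
    · have hfmC : C.fanout (.var xm) = 3 := by rw [← S.fanout_var_eq hmk hr]; exact hfm
      exact hno3 handC hGmC hfmC
    · exact hr hr'

/-- **Case 8.2.5.2 with a one-gate path, mapped back to `C`** (Case 8.2.5.2.1.1 and the
protected case): `I` reads `x_j` and `x_ℓ` directly, so depends on `x_ℓ`, which is then
protected (all variables `I` depends on are); a protected variable is read once in `C`, so its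
`3` readers in `K` come from `P_k = x_k ⊕ x_ℓ` being a `3⁺`-gate, and Case 1 inside `K` applies
(`stepGoal_of_protected_fanout_three`). [cite: LiYang2022, §4.1 (Cases 8.2.5.2.1.1, 8.2.5.2.2, 8.2.5.3)] -/
theorem stepGoal_of_conf8252a (hf : IsAffineDisperser f d) (hd : 2 * d + 2 < R.dim)
    (hφ : 0 ≤ αφ) (hI : 0 ≤ αI)
    {I' : Fin S.K.m} {a : Fin 2} {xl : Fin n} (hIK : I' ∈ S.K.xorPart)
    (hIj : S.K.arg I' a = .var S.xj) (hIl : S.K.arg I' a.rev = .var xl) (hlj : xl ≠ S.xj)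
    (hfl : 3 ≤ S.K.fanout (.var xl)) (HYP : ∀ s, S.K.DependsOn S.fair I' s → R.Protected s) :
    C.StepGoal f R αφ αI αQ := by
  have hdepl : S.K.DependsOn S.fair I' xl := dependsOn_var_of_reads_vars S.fair hIK hIj hIl hlj.symm
  have hxl : R.Protected xl := HYP xl hdepl
  have hlk : xl ≠ S.xk := fun e => S.arg_ne_var_xk hS I' a.rev (e ▸ hIl)
  by_cases hr : C.arg S.Pk S.ak.rev = .var xl
  · exact S.stepGoal_of_protected_fanout_three hf hd hφ hI hxl hlj hlk hfl
  · exfalso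
    have h1 : C.fanout (.var xl) = 1 := by
      rcases S.arg_var_cases hS hIl with h | ⟨-, h⟩
      · exact hS.fanout_eq_one_of_protected hxl h
      · exact absurd h hr
    rw [S.fanout_var_eq hlk hr] at hfl
    omega

/-- **Case 8.2.2, the induction over the path** (Cases 8.2.2.1, 8.2.5, 8.2.5.3–8.2.5.4): for an
∧-type gate `G` of `K` reading at `aI` a `2⁺`-gate `I` of the xor-part which depends on `x_j`
and only on `x_j` and protected variables (the other wire of `G` not ∧-type), with a path from
`x_j` to `I`, the one-step conclusion holds for `C`: by `case8_2_2_K`, either the generic bound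
`Δμ ≥ (1 + α_I + α_Q) + (4 - 2α_φ + α_I) ≥ 2δ` over the two substitutions, or Case 8.2.5.1
(`stepGoal_of_conf8251`), or Case 8.2.5.2 on a one-gate path (`stepGoal_of_conf8252a`), or an
∧-type gate `T` reads the path gate `B` preceding `I` and a variable: then either `B` depends on
an unprotected variable and Case 8.1 applies to `T` in `C` (Cases 8.2.5.2.1.2–5: "`T` is a
topologically minimal ∧-type gate fed by an ⊕-type gate `B` depending on the unprotected variable
`x_ℓ`"), or `T`, `B` and the shorter path are again in the situation of the theorem.
[cite: LiYang2022, §4.1 (Cases 8.2.2.1, 8.2.5.1, 8.2.5.2, 8.2.5.3, 8.2.5.4)] -/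
theorem case8_2_2_induct (hf : IsAffineDisperser f d) (hd : 2 * d + 2 < R.dim) (hF : C.Fair)
    (hC : C.ComputesRestr f R) (hφ : 0 ≤ αφ) (hφ2 : αφ ≤ 1 / 2) (hI : 0 ≤ αI) (hQ : 0 ≤ αQ)
    (hxj1 : S.K.fanout (.var S.xj) = 1) :
    ∀ (len : ℕ) {kG I' : Fin S.K.m} {aI : Fin 2} (p : S.K.XorPath S.xj I'), p.len = len →
      IsAndOp (S.K.op kG) → S.K.arg kG aI = .gate I' →
      (∀ k, S.K.arg kG aI.rev = .gate k → ¬ IsAndOp (S.K.op k)) →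
      S.K.DependsOn S.fair I' S.xj → 2 ≤ S.K.fanout (.gate I') →
      (∀ s, S.K.DependsOn S.fair I' s → R.Protected s) → C.StepGoal f R αφ αI αQ := by
  intro len
  induction len using Nat.strong_induction_on with
  | _ len ih =>
  intro kG I' aI p hlen hand hGI hw hdep hI2 HYP
  have hd₁ : 2 * d + 2 ≤ S.R₁.dim := by have := S.dim_add_one; omega
  rcases case8_2_2_K hf hd₁ S.fair S.computes S.normalized S.noTroubled hφ hI αQ hand hGI hw p hdep
      S.not_protected_xj hxj1 hI2 with hraw | hO1 | hO2 | hO3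
  · -- the generic bound: two substitutions, `Δμ ≥ 5 - 2α_φ + 2α_I + α_Q ≥ 2δ`
    obtain ⟨C', R', P', hF', hC', hP', hdim, hμ⟩ := hraw
    have hdim₁ := S.dim_add_one
    refine Or.inr ⟨2, by norm_num, by norm_num, C', R', P', hF', hC', hP', by omega, ?_⟩
    have h1 := S.measure_le
    have hδ := two_liYangDelta_le_five αφ αI αQ
    push_cast
    linarith
  · obtain ⟨xm, T, aT, hGm, hfm, hTG, hTand, hTm⟩ := hO1
    exact S.stepGoal_of_conf8251 hS hf hd hF hC hφ hφ2 hI hQ hand hGm hfm hTG hTand hTm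
  · obtain ⟨hlen0, xl, hother, hlj, hfl⟩ := hO2
    have h0 : (0 : Fin (p.len + 1)) = Fin.last p.len := p.eq_last_of_len_eq_zero hlen0 0
    have hIj : S.K.arg I' (p.pos (Fin.last p.len)) = .var S.xj := by
      have h := p.arg_zero
      rw [h0, p.gate_last] at h
      exact h
    have hIl : S.K.arg I' (p.pos (Fin.last p.len)).rev = .var xl := by
      have h := hother
      unfold XorPath.other at h
      rw [p.gate_last] at h
      exact h
    exact S.stepGoal_of_conf8252a hS hf hd hφ hI p.last_mem_xorPart hIj hIl hlj hfl HYP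
  · obtain ⟨hpos, T, aT, t, xl, -, hTand, hTB, hTt, hother, hlj⟩ := hO3
    have hBK : p.gate (p.prev (Fin.last p.len)) ∈ S.K.xorPart := p.mem_xorPart _
    have hIB : S.K.arg I' (p.pos (Fin.last p.len)) = .gate (p.gate (p.prev (Fin.last p.len))) :=
      p.arg_last_pos hpos
    have hIl : S.K.arg I' (p.pos (Fin.last p.len)).rev = .var xl := by
      have h := hother
      unfold XorPath.other at h
      rw [p.gate_last] at h
      exact h
    have hdepB : S.K.DependsOn S.fair (p.gate (p.prev (Fin.last p.len))) S.xj :=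
      dependsOn_gate_of_reads S.fair p.last_mem_xorPart (a := (p.pos (Fin.last p.len)).rev) hIl
        (by rw [Fin.rev_rev]; exact hIB) hlj.symm hdep
    have hTandC : IsAndOp (C.op (S.E.ι T)) := (S.E.isAndOp_iff T).mp hTand
    have hBC : S.E.ι (p.gate (p.prev (Fin.last p.len))) ∈ C.xorPart := (S.mem_xorPart_iff _).mp hBK
    have hI'T : I' ≠ T := fun e => (S.K.not_mem_xorPart_of_isAndOp hTand) (e ▸ p.last_mem_xorPart)
    have hfBK : 2 ≤ S.K.fanout (.gate (p.gate (p.prev (Fin.last p.len)))) := two_le_fanout_of_ne hI'T hIB hTB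
    by_cases hunp : ∃ s, ¬ R.Protected s ∧ C.DependsOn hF (S.E.ι (p.gate (p.prev (Fin.last p.len)))) s
    · -- `B` depends on an unprotected variable: Case 8.1 at `T` in `C`
      obtain ⟨s, hsp, hdeps⟩ := hunp
      rcases S.arg_gate_cases hS hTB with hTBC | ⟨hTPk, hrB⟩
      · -- `T` reads `B` directly
        rcases S.arg_var_cases hS hTt with hTtC | ⟨-, hrt⟩
        · exact stepGoal_of_stepBranch2 (case8_1 hf hd hF hC C.isPacking_empty hφ (by linarith) hI αQ hS hTandC
            hTBC hBC hdeps hsp (Or.inr (Or.inl ⟨t, hTtC⟩)))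
        · -- the other wire is `P_k = x_k ⊕ t`: `B` keeps its readers `I` and `T`
          have hne : C.arg S.Pk S.ak.rev ≠ .gate (S.E.ι (p.gate (p.prev (Fin.last p.len)))) := by
            rw [hrt]; exact fun h => by cases h
          have h := S.fanout_gate_add hne
          have hfB : 2 ≤ C.fanout (.gate (S.E.ι (p.gate (p.prev (Fin.last p.len))))) := by omega
          exact stepGoal_of_stepBranch2 (case8_1 hf hd hF hC C.isPacking_empty hφ (by linarith) hI αQ hS hTandC
            hTBC hBC hdeps hsp (Or.inl hfB))
      · -- `T` reads `P_k = x_k ⊕ B`: the other wire of `T` is the variable `t`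
        have hTtC : C.arg (S.E.ι T) aT.rev = .var t := by
          rcases S.arg_var_cases hS hTt with h | ⟨-, h⟩
          · exact h
          · rw [hrB] at h; cases h
        have hsk : s ≠ S.xk := fun e => hsp (e ▸ S.protected_xk)
        exact stepGoal_case8_1_varGate hf hd hF hC hS hφ (by linarith) hI αQ S.hPk hrB hBC
          (hS.isXorOp_of_protected S.protected_xk S.hPk) hdeps hsk hsp hTandC hTPk (Or.inr (Or.inl ⟨t, hTtC⟩))
    · -- `B` depends only on protected variables: the induction hypothesis at `T`, `B`, shorter path
      push Not at hunp
      have HYPB : ∀ s, S.K.DependsOn S.fair (p.gate (p.prev (Fin.last p.len))) s → R.Protected s := by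
        intro s hs
        by_contra hsp
        exact hunp s hsp (S.dependsOn_C hF hBK hs)
      have hwT : ∀ k, S.K.arg T aT.rev = .gate k → ¬ IsAndOp (S.K.op k) := by
        intro k hk; rw [hTt] at hk; cases hk
      exact ih (p.len - 1) (by omega) (p.dropLast hpos) (p.dropLast_len hpos) hTand hTB hwT hdepB hfBK HYPB

end Standing

/-- **Case 8.2.2 of Li–Yang's proof of Theorem 4.1** ("Assume that `Q` is a `2⁺`-gate"), with
its deferred sub-cases 8.2.5.x: under the standing assumptions and with no ∧-type gate fed by
two variables, for a topologically minimal ∧-type gate `G` (its gate inputs in the xor-part)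
reading at `aQ` a `2⁺`-gate `Q` of the xor-part all of whose variables are protected (the
hypothesis of Case 8.2, `Case82Hyp`), the one-step conclusion holds at the empty packing: pick
`x_j ∈ supp(Q)` with couple `x_k` (read by `P_k`; if `P_k = x_k ⊕ x_j`, Case 8.2.1), substitute
`x_k := d` (Case 6: `Δμ ≥ 1 + α_I + α_Q`, the situation `ProtSubstSit`), locate `G` and the
`2⁺`-gate `I ∈ {Q, Q′}` it reads in the new circuit (`exists_conf`), and run the induction
`case8_2_2_induct` along a path from `x_j` to `I`. [cite: LiYang2022, §4.1 (Cases 8.2.1, 8.2.2, 8.2.5)] -/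
theorem case8_2_2 (hf : IsAffineDisperser f d) (hd : 2 * d + 2 < R.dim) (hF : C.Fair)
    (hC : C.ComputesRestr f R) (hS : C.Standing R) (h2 : C.NoAndTwoVars)
    (hφ : 0 ≤ αφ) (hφ2 : αφ ≤ 1 / 2) (hI : 0 ≤ αI) (hQ : 0 ≤ αQ)
    {G Q : Fin C.m} {aQ : Fin 2} (hH : C.Case82Hyp hF R G Q aQ)
    (hGin : ∀ (a : Fin 2) (k : Fin C.m), C.arg G a = .gate k → k ∈ C.xorPart)
    (hQ2 : 2 ≤ C.fanout (.gate Q)) : C.StepGoal f R αφ αI αQ := by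
  obtain ⟨hand, hGQ, hQK, hprot, -⟩ := hH
  -- a variable `x_j` on which `Q` depends, protected
  obtain ⟨xj, hdepj⟩ := exists_dependsOn_of_nonDegenerate hF hS.nonDegenerate hQK
  have hxj : R.Protected xj := hprot xj hdepj
  -- the protected substitution `x_k := 0` (Case 6)
  rcases stepGoal_or_protSubstSit hf hd hF hC hS h2 hφ hφ2 hI hQ hxj (0 : ZMod 2) with h | ⟨S, hSj, -⟩
  · exact h
  subst hSj
  -- `x_j` is read once in `K` (if `P_k` read `x_j`, Case 8.2.1)
  by_cases hr : C.arg S.Pk S.ak.rev = .var S.xj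
  · exact case8_2_1 hf hd hF hC hS hφ hφ2 hI hQ S.hPk hr S.he S.hkr
      (S.e.other_eq_of_reads S.hkr S.hjr S.xj_ne_xk.symm)
  have hxj1 : S.K.fanout (.var S.xj) = 1 := by
    obtain ⟨P, a, hPx, -⟩ := hS.exists_reader_of_protected S.protected_xj
    rw [S.fanout_var_eq S.xj_ne_xk hr]
    exact hS.fanout_eq_one_of_protected S.protected_xj hPx
  -- the configuration in `K`
  rcases S.exists_conf hf hd hF hC hS hφ hφ2 hI hQ hand hGQ hQK hprot hdepj with h | ⟨kG, I, hkG, hkand, hkI, hIK, hdepI, hfan, hIQ⟩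
  · exact h
  have HYP : ∀ s, S.K.DependsOn S.fair I s → R.Protected s := by
    intro s hs
    have hsk : s ≠ S.xk := fun e => S.not_dependsOn_xk hF I (e ▸ hs)
    have hsC := S.dependsOn_C hF hIK hs
    rcases hIQ with hIQ | ⟨hQPk, hQI⟩
    · rw [hIQ] at hsC; exact hprot s hsC
    · subst hQPk
      exact hprot s (dependsOn_of_reads_gate hF hQK S.hPk hQI hsk hsC)
  have hw : ∀ k, S.K.arg kG aQ.rev = .gate k → ¬ IsAndOp (S.K.op k) := by
    intro k hk hak
    have hakC : IsAndOp (C.op (S.E.ι k)) := (S.E.isAndOp_iff k).mp hak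
    rcases S.arg_gate_cases hS hk with h | ⟨hGPk, hrk⟩
    · rw [hkG] at h
      exact not_isAndOp_of_isXorOp (C.isXorOp_of_mem _ (hGin _ _ h)) hakC
    · rw [hkG] at hGPk
      have hPkK : S.Pk ∈ C.xorPart := hGin _ _ hGPk
      exact not_isAndOp_of_isXorOp (C.isXorOp_of_mem _ (C.mem_of_arg_eq S.Pk hPkK _ _ hrk)) hakC
  obtain ⟨p⟩ := S.K.exists_xorPath S.fair hIK hdepI
  exact S.case8_2_2_induct hS hf hd hF hC hφ hφ2 hI hQ hxj1 p.len p rfl hkand hkI hw hdepI (le_trans hQ2 hfan) HYP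

end ProtSubstSit

end Semicircuit

end Literature.Computability.Complexity
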